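import Literature.Topology.FourManifolds.IntersectionLattice
import HarnessLib

/-!
# Compatibility of smooth and homological orientations (trunk T-4MAN)

The bridge between the two notions of orientation in the tree: G18's **smooth** orientations
`Literature.SmoothOrientation (𝓡 n) M` (an orientation of the model space at each point, read in the
preferred chart, locally constant along chart changes; used by `Literature.Topology.FourManifolds.HomotopySphere`, `Θₙ`,
connected sums) and G04's **homological** `ℤ`-orientations `Literature.HomologicalOrientation ℤ M n`
(consistent generators `μₓ ∈ Hₙ(M | x; ℤ)`; used by fundamental classes, intersection forms and
signatures). It is needed to state §7 of Kervaire–Milnor, *Groups of homotopy spheres I* (1963)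
(signatures of manifolds bounded by **oriented** homotopy spheres; layer 2 of the decomposition of
`Literature.Topology.FourManifolds.exists_commGroup_homotopySphereClass_isCyclic_seven`), where the homotopy spheres carry
smooth orientations and the signature is homological (`BoundarySignature.lean`).

## Informal content

Classically (Bredon, *Topology and Geometry* (1993), VI.7, in particular Prop. 7.14–Thm. 7.15;
Milnor–Stasheff, *Characteristic Classes* (1974), Appendix A, pp. 122–123) a smooth orientation
of `M` determines a homological one: at `x`, a positively oriented chart `φ` identifies
`Hₙ(M | x; ℤ) ≅ Hₙ(ℝⁿ | φ x; ℤ)`, and `μₓ` is the class corresponding to **the** preferred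
generator of `Hₙ(ℝⁿ, ℝⁿ ∖ pt; ℤ)` (the class of a positively oriented linear simplex around the
point). G04 has no preferred generator of `Hₙ(ℝⁿ, ℝⁿ ∖ 0; ℤ)` (the groups `Hₙ(𝔻ⁿ, 𝕊ⁿ⁻¹)`,
`Hₙ₋₁(𝕊ⁿ⁻¹)` are only known up to non-canonical isomorphism, as named facts), so the universal
sign is made a **parameter**: a homological orientation `g : HomologicalOrientation ℤ (𝔼 n) n` of
Euclidean space itself (there are exactly two, `±g`, `𝔼 n` being connected;
`HomologicalOrientation.eq_or_eq_neg_of_connected`), thought of as the generator assigned to the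
standard smooth orientation `euclideanOrientation n`. All statements of Kervaire–Milnor §7 are
invariant under `g ↦ -g` (every signature changes sign).

* `Literature.SmoothOrientation.IsCompatibleAt g o μ x`: in the preferred chart `φ = chartAt x` (source
  `U ∋ x`, an open subspace), there is a local class `c ∈ Hₙ(U | x; ℤ)` pushing forward to `μₓ` in
  `Hₙ(M | x; ℤ)` along `U ⊆ M` and to `ε • g_{φ x}` in `Hₙ(𝔼 n | φ x; ℤ)` along `φ|U`, where the sign
  `ε = ±1` is `+1` exactly when the chart is positively oriented at `x`, i.e. when
  `o x = euclideanOrientation n` (by definition of `SmoothOrientation`, `o x` *is* the orientation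
  of the model space read in `chartAt x`). Both push-forwards are excision isomorphisms
  (Hatcher 2002, §3.3, p. 231), which is not needed to state the condition.
* `Literature.SmoothOrientation.IsCompatible g o μ`: compatibility at every point; the named fact
  `Literature.Topology.FourManifolds.SmoothOrientation.existsUnique_isCompatible` (Bredon VI.7.15; Milnor–Stasheff App. A):
  every smooth orientation has exactly one compatible homological orientation.

## Mathlib / tree

Mathlib has neither notion of orientation of a manifold. The tree's `IntersectionLattice.lean`
records only the orientability-level bridge (`isOrientable_iff_isOrientableOver_int`, named
fact); nothing relates an individual smooth orientation to an individual homological one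
(searched `toHomological`, `IsCompatible`, `HomologicalOrientation` in `FourManifolds/`).
-/

open scoped Manifold ContDiff Topology
open Set Function CategoryTheory Module

noncomputable section

universe u

namespace Literature.Topology.FourManifolds

/-- Local notation: `𝔼 n` is the model Euclidean space `EuclideanSpace ℝ (Fin n)`. -/
local notation "𝔼 " n:arg => EuclideanSpace ℝ (Fin n)

section localHomology
open Literature.AlgebraicTopology.SingularHomology (localHomology)
open Literature.AlgebraicTopology.SingularHomology.localHomology

variable {X Y : Type u} [TopologicalSpace X] [TopologicalSpace Y]

/-- Push-forward of local homology at a point along a map `f` that does not hit `b = f a`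
outside `a` (e.g. any injective map): `f_* : Hₙ(X | a) ⟶ Hₙ(Y | b)`, the map of pairs
`(X, X ∖ a) → (Y, Y ∖ b)` (Hatcher 2002, §3.3, p. 231). For the inclusion of an open neighbourhood
this is the excision isomorphism. The target point `b` is an explicit argument, so that the
codomain is syntactically `Hₙ(Y | b)`; only `hf` (which is exactly `MapsTo f {a}ᶜ {b}ᶜ` and does not
force `f a = b`) is needed. [cite: Hatcher2002, §3.3, p. 231] -/
def _root_.Literature.AlgebraicTopology.SingularHomology.localHomology.push (f : C(X, Y)) (a : X) (b : Y) (hf : ∀ y, f y = b → y = a) (n : ℕ) :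
    localHomology ℤ ℤ X a n ⟶ localHomology ℤ ℤ Y b n :=
  Literature.AlgebraicTopology.SingularHomology.relativeSingularHomology.map ℤ ℤ f
    (show MapsTo f {a}ᶜ {b}ᶜ from
      fun y hy h => hy (by rw [mem_singleton_iff] at h ⊢; exact hf y h)) n

/-- `push` is G04's map of pairs `(X, X ∖ a) → (Y, Y ∖ b)`. [folklore] -/
theorem _root_.Literature.AlgebraicTopology.SingularHomology.localHomology.push_def (f : C(X, Y)) (a : X) (b : Y) (hf : ∀ y, f y = b → y = a) (n : ℕ) :
    push f a b hf n = Literature.AlgebraicTopology.SingularHomology.relativeSingularHomology.map ℤ ℤ f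
      (show MapsTo f {a}ᶜ {b}ᶜ from
        fun y hy h => hy (by rw [mem_singleton_iff] at h ⊢; exact hf y h)) n := rfl

end localHomology

namespace SmoothOrientation

/-! The manifold `M` lives in `Type` (universe `0`), like the carriers of `Literature.Topology.FourManifolds.HomotopySphere`:
G04's maps of pairs relate spaces in a common universe, and the model `𝔼 n` is in `Type`. -/

variable {n : ℕ} {M : Type} [TopologicalSpace M] [ChartedSpace (𝔼 n) M]

/-- The source of the preferred chart at `x`, as a subspace, with its point `x`. [folklore] -/
abbrev chartSourcePt (x : M) : ↥(chartAt (𝔼 n) x).source := ⟨x, mem_chart_source (𝔼 n) x⟩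

/-- The preferred chart at `x` restricted to its source, as a continuous map into the model space
`𝔼 n` (`OpenPartialHomeomorph.continuousOn` restricted). [folklore] -/
def chartRestrict (x : M) : C(↥(chartAt (𝔼 n) x).source, 𝔼 n) :=
  ⟨(chartAt (𝔼 n) x).source.restrict (chartAt (𝔼 n) x),
    (chartAt (𝔼 n) x).continuousOn.restrict⟩

/-- The restricted chart has the values of the chart. [folklore] -/
@[simp] theorem chartRestrict_apply (x : M) (y : ↥(chartAt (𝔼 n) x).source) :
    chartRestrict x y = chartAt (𝔼 n) x y := rfl

/-- `φ|U` hits `φ x` only at `x` (injectivity of the chart on its source). [folklore] -/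
theorem chartRestrict_eq_imp (x : M) (y : ↥(chartAt (𝔼 n) x).source)
    (h : chartRestrict x y = chartAt (𝔼 n) x x) : y = chartSourcePt x :=
  Subtype.ext ((chartAt (𝔼 n) x).injOn y.2 (mem_chart_source (𝔼 n) x) h)

/-- The inclusion `U ⊆ M` hits `x` only at `x`. [folklore] -/
theorem subtypeVal_eq_imp (x : M) (y : ↥(chartAt (𝔼 n) x).source) (h : (y : M) = x) :
    y = chartSourcePt x :=
  Subtype.ext h

/-- `μₓ` pulled back to the chart domain and pushed into the model: the two push-forwards used in
`IsCompatibleAt`, `Hₙ(U | x) ⟶ Hₙ(M | x)` (inclusion; an excision isomorphism) and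
`Hₙ(U | x) ⟶ Hₙ(𝔼 n | φ x)` (the chart). [folklore] -/
abbrev pushIncl (x : M) (k : ℕ) :
    Literature.AlgebraicTopology.SingularHomology.localHomology ℤ ℤ (↥(chartAt (𝔼 n) x).source) (chartSourcePt x) k ⟶ Literature.AlgebraicTopology.SingularHomology.localHomology ℤ ℤ M x k :=
  Literature.AlgebraicTopology.SingularHomology.localHomology.push ⟨Subtype.val, continuous_subtype_val⟩ (chartSourcePt x) x
    (subtypeVal_eq_imp x) k

/-- See `pushIncl`. [folklore] -/
abbrev pushChart (x : M) (k : ℕ) :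
    Literature.AlgebraicTopology.SingularHomology.localHomology ℤ ℤ (↥(chartAt (𝔼 n) x).source) (chartSourcePt x) k ⟶
      Literature.AlgebraicTopology.SingularHomology.localHomology ℤ ℤ (𝔼 n) (chartAt (𝔼 n) x x) k :=
  Literature.AlgebraicTopology.SingularHomology.localHomology.push (chartRestrict x) (chartSourcePt x) (chartAt (𝔼 n) x x)
    (chartRestrict_eq_imp x) k

/-- `pushIncl` is additive, in particular commutes with negation. [folklore] -/
theorem pushIncl_neg (x : M) (k : ℕ)
    (c : Literature.AlgebraicTopology.SingularHomology.localHomology ℤ ℤ (↥(chartAt (𝔼 n) x).source) (chartSourcePt x) k) :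
    pushIncl x k (-c) = -pushIncl x k c :=
  map_neg _ _

/-- `pushChart` is additive, in particular commutes with negation. [folklore] -/
theorem pushChart_neg (x : M) (k : ℕ)
    (c : Literature.AlgebraicTopology.SingularHomology.localHomology ℤ ℤ (↥(chartAt (𝔼 n) x).source) (chartSourcePt x) k) :
    pushChart x k (-c) = -pushChart x k c :=
  map_neg _ _

variable [IsManifold (𝓡 n) 1 M]

/-- **Compatibility of a smooth and a homological orientation at a point**, relative to the
generator convention `g` (a homological orientation of `𝔼 n`, standing for the preferred
generator of `Hₙ(ℝⁿ, ℝⁿ ∖ pt; ℤ)` attached to the standard smooth orientation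
`euclideanOrientation n`). With `φ = chartAt x`, `U = φ.source`: some local class
`c ∈ Hₙ(U | x; ℤ)` maps to `μₓ ∈ Hₙ(M | x; ℤ)` under the inclusion `U ⊆ M` and to `ε • g_{φ x}`
under `φ|U : U → 𝔼 n`, where the sign `ε ∈ ℤˣ = {±1}` is `1` iff `φ` is positively oriented at `x` for `o`, i.e.
iff `o x = euclideanOrientation n` (`o x` is read in `chartAt x` by definition of
`SmoothOrientation`). Bredon, *Topology and Geometry* (1993), VI.7 (Prop. 7.14, Thm. 7.15);
Milnor–Stasheff (1974), Appendix A, pp. 122–123; Hatcher 2002, §3.3, pp. 231, 233–236. [cite: Bredon1993, VI.7, Prop. 7.14 and Thm. 7.15] [cite: MilnorStasheff1974, Appendix A, pp. 122–123] -/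
def IsCompatibleAt (g : Literature.AlgebraicTopology.SingularHomology.HomologicalOrientation ℤ (𝔼 n) n) (o : SmoothOrientation (𝓡 n) M)
    (μ : Literature.AlgebraicTopology.SingularHomology.HomologicalOrientation ℤ M n) (x : M) : Prop :=
  ∃ (c : Literature.AlgebraicTopology.SingularHomology.localHomology ℤ ℤ (↥(chartAt (𝔼 n) x).source) (chartSourcePt x) n) (ε : ℤˣ),
    pushIncl x n c = μ.localClass x ∧
      pushChart x n c = (ε : ℤ) • g.localClass (chartAt (𝔼 n) x x) ∧
      (ε = 1 ↔ o x = euclideanOrientation n)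

/-- **Compatible smooth and homological orientations** (relative to the generator convention
`g`): compatibility at every point. For `M = Σ` a homotopy sphere with its smooth orientation
(`Literature.Topology.FourManifolds.HomotopySphere.orientation`) the compatible `μ` gives the fundamental class `[Σ]` used in
"`Σ = bM`" (Kervaire–Milnor 1963, §7) via `Literature.Topology.FourManifolds.IsOrientedBoundary`. Bredon 1993, VI.7;
Milnor–Stasheff 1974, Appendix A. [cite: Bredon1993, VI.7, Thm. 7.15] -/
def IsCompatible (g : Literature.AlgebraicTopology.SingularHomology.HomologicalOrientation ℤ (𝔼 n) n) (o : SmoothOrientation (𝓡 n) M)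
    (μ : Literature.AlgebraicTopology.SingularHomology.HomologicalOrientation ℤ M n) : Prop :=
  ∀ x, IsCompatibleAt g o μ x

/-- Unfolding lemma for `IsCompatible` (Bredon 1993, VI.7). [folklore] -/
theorem isCompatible_iff (g : Literature.AlgebraicTopology.SingularHomology.HomologicalOrientation ℤ (𝔼 n) n) (o : SmoothOrientation (𝓡 n) M)
    (μ : Literature.AlgebraicTopology.SingularHomology.HomologicalOrientation ℤ M n) :
    IsCompatible g o μ ↔ ∀ x, IsCompatibleAt g o μ x := Iff.rfl

/-- **Reversing both orientations preserves compatibility** at a point: `-o` is compatible with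
`-μ` (negate the local class and the sign `ε`; the chart at `x` is positively oriented for `-o`
iff it is not for `o`, `Orientation.ne_iff_eq_neg`). Bredon 1993, VI.7; Kervaire–Milnor 1963, §2
("`-M`"). [cite: Bredon1993, VI.7] -/
theorem IsCompatibleAt.neg {g : Literature.AlgebraicTopology.SingularHomology.HomologicalOrientation ℤ (𝔼 n) n} {o : SmoothOrientation (𝓡 n) M}
    {μ : Literature.AlgebraicTopology.SingularHomology.HomologicalOrientation ℤ M n} {x : M} (h : IsCompatibleAt g o μ x) :
    IsCompatibleAt g (-o) (-μ) x := by
  obtain ⟨c, ε, h₁, h₂, h₃⟩ := h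
  refine ⟨-c, -ε, ?_, ?_, ?_⟩
  · rw [pushIncl_neg, h₁, Literature.AlgebraicTopology.SingularHomology.HomologicalOrientation.neg_localClass]
  · rw [pushChart_neg, h₂, Units.val_neg]
    simp only [neg_zsmul]
  · rw [SmoothOrientation.neg_apply,
      (neg_eq_iff_eq_neg (a := o x) (b := euclideanOrientation n)).trans
        (Orientation.ne_iff_eq_neg (o x) (euclideanOrientation n) (by simp)).symm, ne_eq, ← h₃]
    rcases Int.units_eq_one_or ε with rfl | rfl <;> decide

/-- Reversing both orientations preserves compatibility (Bredon 1993, VI.7;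
Kervaire–Milnor 1963, §2). [cite: Bredon1993, VI.7] -/
theorem IsCompatible.neg {g : Literature.AlgebraicTopology.SingularHomology.HomologicalOrientation ℤ (𝔼 n) n} {o : SmoothOrientation (𝓡 n) M}
    {μ : Literature.AlgebraicTopology.SingularHomology.HomologicalOrientation ℤ M n} (h : IsCompatible g o μ) : IsCompatible g (-o) (-μ) :=
  fun x => (h x).neg

/-- **Changing the generator convention negates the compatible homological orientation**:
`o` is `g`-compatible with `μ` iff it is `(-g)`-compatible with `-μ` (pointwise). [folklore] -/
theorem IsCompatibleAt.neg_gen {g : Literature.AlgebraicTopology.SingularHomology.HomologicalOrientation ℤ (𝔼 n) n}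
    {o : SmoothOrientation (𝓡 n) M} {μ : Literature.AlgebraicTopology.SingularHomology.HomologicalOrientation ℤ M n} {x : M}
    (h : IsCompatibleAt g o μ x) : IsCompatibleAt (-g) o (-μ) x := by
  obtain ⟨c, ε, h₁, h₂, h₃⟩ := h
  refine ⟨-c, ε, ?_, ?_, h₃⟩
  · rw [pushIncl_neg, h₁, Literature.AlgebraicTopology.SingularHomology.HomologicalOrientation.neg_localClass]
  · rw [pushChart_neg, h₂, Literature.AlgebraicTopology.SingularHomology.HomologicalOrientation.neg_localClass]
    simp only [zsmul_neg]

/-- Changing the generator convention negates the compatible homological orientation, globally.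
[folklore] -/
theorem IsCompatible.neg_gen {g : Literature.AlgebraicTopology.SingularHomology.HomologicalOrientation ℤ (𝔼 n) n}
    {o : SmoothOrientation (𝓡 n) M} {μ : Literature.AlgebraicTopology.SingularHomology.HomologicalOrientation ℤ M n} (h : IsCompatible g o μ) :
    IsCompatible (-g) o (-μ) :=
  fun x => (h x).neg_gen

variable (n M) in
/-- **Every smooth orientation has exactly one compatible homological orientation** (named fact;
Bredon, *Topology and Geometry* (1993), VI.7, Thm. 7.15 with Prop. 7.14: for smooth manifolds the
smooth and the homological notions of orientation correspond bijectively, compatibly with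
reversal; Milnor–Stasheff 1974, Appendix A, pp. 122–123), for `M` Hausdorff (the setting of
G04's local-homology computations) and any generator convention `g`. Existence: positively
oriented charts overlap with positive Jacobian, and such chart changes act as `+1` on
`Hₙ(ℝⁿ | pt; ℤ)` (degree of an orientation-preserving linear map), so the classes `± g` transported
back are locally consistent; uniqueness: a homological orientation is determined by its local
classes. Call shape: `existsUnique_isCompatible n M` (both explicit). [cite: Bredon1993, VI.7, Thm. 7.15 (with Prop. 7.14)] [cite: MilnorStasheff1974, Appendix A, pp. 122–123] -/
def existsUnique_isCompatible : Prop :=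
  ∀ [T2Space M] (g : Literature.AlgebraicTopology.SingularHomology.HomologicalOrientation ℤ (𝔼 n) n) (o : SmoothOrientation (𝓡 n) M),
    ∃! μ : Literature.AlgebraicTopology.SingularHomology.HomologicalOrientation ℤ M n, IsCompatible g o μ

end SmoothOrientation

end Literature.Topology.FourManifolds
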